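import Summits.NavierStokesRegularity.NavierStokesRegularity.Theorems.ScalingDefectPeepholeDoorTubeCalculus
import Summits.NavierStokesRegularity.NavierStokesRegularity.Theorems.ScalingDefectPeepholeDoorDefs
import Literature.Analysis.FluidPDE.PineauVicolOneSliceCompactness

/-!
# ScalingDefectPeepholeDoorTubeResidual — door S30 «ScalingDefectPeepholeDoor» v2 (nsreg-p1 g24 ROUND-28 v2 6cf1a9889313ec10),
# plate P2 = K1ω `VortexDefectTubeBound`, part T2a: THE HOLOMORPHIC EXTENSION OF THE SELF-SIMILAR RESIDUAL

From a bounded holomorphic extension `U` of a smooth window field `W` on the tube `localComplexTube 0 (A+1) δ₀` (bound `K₀`) to a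
bounded holomorphic extension of the self-similar residual `ssResidual 1 W = ΔW − DW[W] − ½W − ½DW[y]` (Defs §0) on the half-way
shrunken tube, with a bound depending on `(K₀, A, δ₀)` only: two rounds of the `∂ᵥ`-extension lemma of part T1 (coordinate
directions) give `∂ⱼU`, `∂ⱼ∂ⱼU` with Cauchy bounds and real-slice agreement, and the residual is assembled in coordinates,
`N U = Σⱼ ∂ⱼ∂ⱼU − Σⱼ Uⱼ ∂ⱼU − ½U − ½ Σⱼ zⱼ ∂ⱼU` (`ssResidual_one_eq_coord` is the matching real identity).

* `ssResidual_one_eq_coord` — the coordinate form of `ssResidual 1 W y` for `W` of class `C²` near `y`.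
* `exists_ssResidual_extension` — `∀ A δ₀ K₀, ∃ B, ∀ U W, …`: the residual's extension on `localComplexTube 0 (A+1−δ₀/2) (δ₀/2)`,
  bound `B = B(K₀, A, δ₀)`, agreeing with `complexify ∘ ssResidual 1 W` on `B(0, A+1−δ₀/2)`.

Folklore several-complex-variables plumbing; no statement of the door is declared here.  Door S30 is a regularity CRITERION inside a
HYPOTHETICAL local Type-I blow-up (item 0056 `NoTypeII` stays OPEN); nothing here bears on NS regularity itself.
-/

noncomputable section

set_option linter.dupNamespace false

namespace Summit.NavierStokesRegularity.NavierStokesRegularity.Theorems.ScalingDefectPeepholeDoor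

open Set Function Filter Metric TopologicalSpace Complex InnerProductSpace
open scoped Topology Laplacian ContDiff
open Literature.Analysis Literature.Analysis.FluidPDE Literature.Analysis.Complex
open Literature.Analysis.FunctionSpaces.EuclideanSpace (complexify norm_complexify complexify_apply)

-- nested operator types
set_option maxSynthPendingDepth 3

/-! ## §1 The coordinate form of the self-similar residual -/

/-- a linear map of `ℝ³` applied to `v` is `Σⱼ vⱼ • L eⱼ`. -/
theorem clm_apply_eq_sum_smul (L : EuclideanSpace ℝ (Fin 3) →L[ℝ] EuclideanSpace ℝ (Fin 3)) (v : EuclideanSpace ℝ (Fin 3)) :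
    L v = ∑ j : Fin 3, v j • L (EuclideanSpace.single j (1 : ℝ)) := by
  conv_lhs => rw [← (EuclideanSpace.basisFun (Fin 3) ℝ).sum_repr v]
  simp [map_sum, map_smul, EuclideanSpace.basisFun_apply]

/-- **Coordinate form of the self-similar residual**: for `W` differentiable at `y` with `DW` differentiable at `y`,
`ssResidual 1 W y = Σⱼ ∂ⱼ(∂ⱼW)(y) − Σⱼ Wⱼ(y) ∂ⱼW(y) − ½W(y) − ½ Σⱼ yⱼ ∂ⱼW(y)`, `∂ⱼW := DW[eⱼ]`. -/
theorem ssResidual_one_eq_coord {W : EuclideanSpace ℝ (Fin 3) → EuclideanSpace ℝ (Fin 3)} {y : EuclideanSpace ℝ (Fin 3)}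
    (hDW : DifferentiableAt ℝ (fderiv ℝ W) y) :
    ssResidual 1 W y =
      (∑ j : Fin 3, fderiv ℝ (fun y' => fderiv ℝ W y' (EuclideanSpace.single j (1 : ℝ))) y (EuclideanSpace.single j (1 : ℝ)))
        - (∑ j : Fin 3, (W y) j • fderiv ℝ W y (EuclideanSpace.single j (1 : ℝ)))
        - (1 / 2 : ℝ) • W y - (1 / 2 : ℝ) • ∑ j : Fin 3, y j • fderiv ℝ W y (EuclideanSpace.single j (1 : ℝ)) := by
  unfold ssResidual
  rw [one_smul, laplacian_apply_eq_sum_fderiv_fderiv_basisFun, ← clm_apply_eq_sum_smul, ← clm_apply_eq_sum_smul]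
  congr 1
  congr 1
  congr 1
  refine Finset.sum_congr rfl fun j _ => ?_
  rw [EuclideanSpace.basisFun_apply, fderiv_clm_apply hDW (differentiableAt_const _)]
  simp

/-! ## §2 The residual's extension -/

/-- a coordinate of a point of the local tube over `B(0, ρ)` of height `h` is at most `ρ + h` in size. -/
theorem norm_apply_le_of_mem_localComplexTube {ρ h : ℝ} {z : EuclideanSpace ℂ (Fin 3)}
    (hz : z ∈ localComplexTube (0 : EuclideanSpace ℝ (Fin 3)) ρ h) (j : Fin 3) : ‖z j‖ ≤ ρ + h := by
  obtain ⟨x, y, hx, hy, rfl⟩ := hz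
  rw [dist_zero_right] at hx
  have h1 : ‖x j‖ ≤ ‖x‖ := by simpa using PiLp.norm_apply_le (p := 2) x j
  have h2 : ‖y j‖ ≤ ‖y‖ := by simpa using PiLp.norm_apply_le (p := 2) y j
  calc ‖(complexify x + Complex.I • complexify y) j‖ = ‖(x j : ℂ) + Complex.I * (y j : ℂ)‖ := by
        simp [complexify_apply]
    _ ≤ ‖(x j : ℂ)‖ + ‖Complex.I * (y j : ℂ)‖ := norm_add_le _ _
    _ = ‖x j‖ + ‖y j‖ := by rw [norm_mul, Complex.norm_I, one_mul, Complex.norm_real, Complex.norm_real]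
    _ ≤ ρ + h := by linarith

set_option maxHeartbeats 1600000 in
/-- **The self-similar residual of the window field extends holomorphically to the half-way tube with a class bound.**  For
`A ≥ 1`, `δ₀ > 0`, `K₀ ≥ 0` there is `B = B(K₀, A, δ₀)` such that: if `U` is holomorphic on `localComplexTube 0 (A+1) δ₀` with
`‖U‖ ≤ K₀` and agrees with `complexify ∘ W` on `B(0, A+1)`, `W` of class `C³` there, then some `G` holomorphic on
`localComplexTube 0 (A+1−δ₀/2) (δ₀/2)` with `‖G‖ ≤ B` there agrees with `complexify ∘ ssResidual 1 W` on `B(0, A+1−δ₀/2)`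
(two rounds of `dirDeriv_extension` in the coordinate directions, then the coordinate assembly of `ΔU − DU[U] − ½U − ½DU[z]`). -/
theorem exists_ssResidual_extension (A δ₀ K₀ : ℝ) (hA : 1 ≤ A) (hδ₀ : 0 < δ₀) (hK₀ : 0 ≤ K₀) :
    ∃ B : ℝ, 0 ≤ B ∧
    ∀ (U : EuclideanSpace ℂ (Fin 3) → EuclideanSpace ℂ (Fin 3)) (W : EuclideanSpace ℝ (Fin 3) → EuclideanSpace ℝ (Fin 3)),
      DifferentiableOn ℂ U (localComplexTube 0 (A + 1) δ₀) →
      (∀ z ∈ localComplexTube (0 : EuclideanSpace ℝ (Fin 3)) (A + 1) δ₀, ‖U z‖ ≤ K₀) →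
      ContDiffOn ℝ 3 W (ball (0 : EuclideanSpace ℝ (Fin 3)) (A + 1)) →
      (∀ y ∈ ball (0 : EuclideanSpace ℝ (Fin 3)) (A + 1), U (complexify y) = complexify (W y)) →
      ∃ G : EuclideanSpace ℂ (Fin 3) → EuclideanSpace ℂ (Fin 3),
        DifferentiableOn ℂ G (localComplexTube 0 (A + 1 - δ₀ / 2) (δ₀ / 2)) ∧
        (∀ z ∈ localComplexTube (0 : EuclideanSpace ℝ (Fin 3)) (A + 1 - δ₀ / 2) (δ₀ / 2), ‖G z‖ ≤ B) ∧
        ∀ y ∈ ball (0 : EuclideanSpace ℝ (Fin 3)) (A + 1 - δ₀ / 2), G (complexify y) = complexify (ssResidual 1 W y) := by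
  set s : ℝ := δ₀ / 4 with hs_def
  have hs : 0 < s := by positivity
  -- the bound
  refine ⟨3 * (K₀ / s / s) + 3 * (K₀ * (K₀ / s)) + (1 / 2) * K₀ + (1 / 2) * (3 * ((A + 3) * (K₀ / s))), by positivity, ?_⟩
  intro U W hU hUb hW hUW
  set e : Fin 3 → EuclideanSpace ℝ (Fin 3) := fun j => EuclideanSpace.single j (1 : ℝ) with he_def
  have he : ∀ j, ‖e j‖ ≤ 1 := fun j => by simp [he_def]
  have hWd : DifferentiableOn ℝ W (ball (0 : EuclideanSpace ℝ (Fin 3)) (A + 1)) :=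
    hW.differentiableOn (by norm_num)
  -- round 1: `∂ⱼ U`
  set U₁ : Fin 3 → EuclideanSpace ℂ (Fin 3) → EuclideanSpace ℂ (Fin 3) := fun j z => fderiv ℂ U z (complexify (e j))
    with hU₁_def
  set W₁ : Fin 3 → EuclideanSpace ℝ (Fin 3) → EuclideanSpace ℝ (Fin 3) := fun j y => fderiv ℝ W y (e j) with hW₁_def
  have R1 : ∀ j, DifferentiableOn ℂ (U₁ j) (localComplexTube 0 (A + 1) δ₀) ∧
      (∀ z ∈ localComplexTube (0 : EuclideanSpace ℝ (Fin 3)) (A + 1 - s) (δ₀ - s), ‖U₁ j z‖ ≤ K₀ / s) ∧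
      ∀ y ∈ ball (0 : EuclideanSpace ℝ (Fin 3)) (A + 1), U₁ j (complexify y) = complexify (W₁ j y) := fun j =>
    dirDeriv_extension hδ₀ hU hUb hUW hWd hs (he j)
  -- round 2: `∂ⱼ∂ⱼ U` on the once-shrunken tube
  have hW₁ : ∀ j, ContDiffOn ℝ 2 (W₁ j) (ball (0 : EuclideanSpace ℝ (Fin 3)) (A + 1)) := fun j =>
    (hW.fderiv_of_isOpen isOpen_ball (m := 2) (by norm_num)).clm_apply contDiffOn_const
  have hW₁d : ∀ j, DifferentiableOn ℝ (W₁ j) (ball (0 : EuclideanSpace ℝ (Fin 3)) (A + 1 - s)) := fun j =>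
    ((hW₁ j).differentiableOn (by norm_num)).mono (ball_subset_ball (by linarith))
  have hδs : 0 < δ₀ - s := by rw [hs_def]; linarith
  set U₂ : Fin 3 → EuclideanSpace ℂ (Fin 3) → EuclideanSpace ℂ (Fin 3) :=
    fun j z => fderiv ℂ (U₁ j) z (complexify (e j)) with hU₂_def
  set W₂ : Fin 3 → EuclideanSpace ℝ (Fin 3) → EuclideanSpace ℝ (Fin 3) := fun j y => fderiv ℝ (W₁ j) y (e j) with hW₂_def
  have R2 : ∀ j, DifferentiableOn ℂ (U₂ j) (localComplexTube 0 (A + 1 - s) (δ₀ - s)) ∧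
      (∀ z ∈ localComplexTube (0 : EuclideanSpace ℝ (Fin 3)) (A + 1 - s - s) (δ₀ - s - s), ‖U₂ j z‖ ≤ K₀ / s / s) ∧
      ∀ y ∈ ball (0 : EuclideanSpace ℝ (Fin 3)) (A + 1 - s), U₂ j (complexify y) = complexify (W₂ j y) := fun j =>
    dirDeriv_extension hδs ((R1 j).1.mono (localComplexTube_mono (by linarith) (by linarith))) (R1 j).2.1
      (fun y hy => (R1 j).2.2 y (ball_subset_ball (by linarith) hy)) (hW₁d j) hs (he j)
  -- the residual in coordinates
  set T₂ : Set (EuclideanSpace ℂ (Fin 3)) := localComplexTube (0 : EuclideanSpace ℝ (Fin 3)) (A + 1 - δ₀ / 2) (δ₀ / 2)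
    with hT₂_def
  have hT₂eq : A + 1 - s - s = A + 1 - δ₀ / 2 ∧ δ₀ - s - s = δ₀ / 2 := by rw [hs_def]; constructor <;> ring
  have hT₂₁ : T₂ ⊆ localComplexTube 0 (A + 1 - s) (δ₀ - s) := by
    rw [hT₂_def, ← hT₂eq.1, ← hT₂eq.2]; exact localComplexTube_mono (by linarith) (by linarith)
  have hT₂₀ : T₂ ⊆ localComplexTube 0 (A + 1) δ₀ := hT₂₁.trans (localComplexTube_mono (by linarith) (by linarith))
  set G : EuclideanSpace ℂ (Fin 3) → EuclideanSpace ℂ (Fin 3) := fun z =>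
    (∑ j : Fin 3, U₂ j z) - (∑ j : Fin 3, (U z) j • U₁ j z) - (1 / 2 : ℝ) • U z
      - (1 / 2 : ℝ) • ∑ j : Fin 3, (z j) • U₁ j z with hG_def
  refine ⟨G, ?_, ?_, ?_⟩
  · -- holomorphy on `T₂`
    have hUT : DifferentiableOn ℂ U T₂ := hU.mono hT₂₀
    have hU₁T : ∀ j, DifferentiableOn ℂ (U₁ j) T₂ := fun j => (R1 j).1.mono hT₂₀
    have hU₂T : ∀ j, DifferentiableOn ℂ (U₂ j) T₂ := fun j => (R2 j).1.mono hT₂₁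
    have hUj : ∀ j, DifferentiableOn ℂ (fun z => U z j) T₂ := fun j => differentiableOn_euclidean.1 hUT j
    have hzj : ∀ j : Fin 3, DifferentiableOn ℂ (fun z : EuclideanSpace ℂ (Fin 3) => z j) T₂ := fun j =>
      differentiableOn_euclidean.1 differentiableOn_id j
    have h1 : DifferentiableOn ℂ (fun z => ∑ j : Fin 3, U₂ j z) T₂ := DifferentiableOn.fun_sum fun j _ => hU₂T j
    have h2 : DifferentiableOn ℂ (fun z => ∑ j : Fin 3, (U z) j • U₁ j z) T₂ :=
      DifferentiableOn.fun_sum fun j _ => (hUj j).smul (hU₁T j)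
    have h3 : DifferentiableOn ℂ (fun z => (1 / 2 : ℝ) • U z) T₂ := hUT.const_smul (1 / 2 : ℝ)
    have h4 : DifferentiableOn ℂ (fun z => (1 / 2 : ℝ) • ∑ j : Fin 3, (z j) • U₁ j z) T₂ :=
      (DifferentiableOn.fun_sum fun j _ => (hzj j).smul (hU₁T j)).const_smul (1 / 2 : ℝ)
    exact ((h1.sub h2).sub h3).sub h4
  · -- the bound on `T₂`
    intro z hz
    have hz₁ : z ∈ localComplexTube (0 : EuclideanSpace ℝ (Fin 3)) (A + 1 - s - s) (δ₀ - s - s) := by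
      rw [hT₂eq.1, hT₂eq.2]; exact hz
    have bU : ‖U z‖ ≤ K₀ := hUb z (hT₂₀ hz)
    have bU₁ : ∀ j, ‖U₁ j z‖ ≤ K₀ / s := fun j => (R1 j).2.1 z (hT₂₁ hz)
    have bU₂ : ∀ j, ‖U₂ j z‖ ≤ K₀ / s / s := fun j => (R2 j).2.1 z hz₁
    have bzj : ∀ j, ‖z j‖ ≤ A + 3 := fun j => by
      have := norm_apply_le_of_mem_localComplexTube hz j
      linarith
    have bUj : ∀ j, ‖U z j‖ ≤ K₀ := fun j => le_trans (by simpa using PiLp.norm_apply_le (p := 2) (U z) j) bU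
    have hKs : 0 ≤ K₀ / s := by positivity
    have e1 : ‖∑ j : Fin 3, U₂ j z‖ ≤ 3 * (K₀ / s / s) := by
      calc ‖∑ j : Fin 3, U₂ j z‖ ≤ ∑ j : Fin 3, ‖U₂ j z‖ := norm_sum_le _ _
        _ ≤ ∑ _j : Fin 3, K₀ / s / s := Finset.sum_le_sum fun j _ => bU₂ j
        _ = 3 * (K₀ / s / s) := by simp
    have e2 : ‖∑ j : Fin 3, (U z) j • U₁ j z‖ ≤ 3 * (K₀ * (K₀ / s)) := by
      calc ‖∑ j : Fin 3, (U z) j • U₁ j z‖ ≤ ∑ j : Fin 3, ‖(U z) j • U₁ j z‖ := norm_sum_le _ _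
        _ ≤ ∑ _j : Fin 3, K₀ * (K₀ / s) := Finset.sum_le_sum fun j _ => by
            rw [norm_smul]; exact mul_le_mul (bUj j) (bU₁ j) (norm_nonneg _) hK₀
        _ = 3 * (K₀ * (K₀ / s)) := by simp
    have e3 : ‖(1 / 2 : ℝ) • U z‖ ≤ (1 / 2) * K₀ := by
      rw [norm_smul, Real.norm_of_nonneg (by norm_num : (0 : ℝ) ≤ 1 / 2)]
      exact mul_le_mul_of_nonneg_left bU (by norm_num)
    have e4 : ‖(1 / 2 : ℝ) • ∑ j : Fin 3, (z j) • U₁ j z‖ ≤ (1 / 2) * (3 * ((A + 3) * (K₀ / s))) := by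
      rw [norm_smul, Real.norm_of_nonneg (by norm_num : (0 : ℝ) ≤ 1 / 2)]
      refine mul_le_mul_of_nonneg_left ?_ (by norm_num)
      calc ‖∑ j : Fin 3, (z j) • U₁ j z‖ ≤ ∑ j : Fin 3, ‖(z j) • U₁ j z‖ := norm_sum_le _ _
        _ ≤ ∑ _j : Fin 3, (A + 3) * (K₀ / s) := Finset.sum_le_sum fun j _ => by
            rw [norm_smul]; exact mul_le_mul (bzj j) (bU₁ j) (norm_nonneg _) (by linarith)
        _ = 3 * ((A + 3) * (K₀ / s)) := by simp
    calc ‖G z‖ ≤ ‖(∑ j : Fin 3, U₂ j z) - (∑ j : Fin 3, (U z) j • U₁ j z) - (1 / 2 : ℝ) • U z‖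
          + ‖(1 / 2 : ℝ) • ∑ j : Fin 3, (z j) • U₁ j z‖ := norm_sub_le _ _
      _ ≤ (‖(∑ j : Fin 3, U₂ j z) - (∑ j : Fin 3, (U z) j • U₁ j z)‖ + ‖(1 / 2 : ℝ) • U z‖)
          + ‖(1 / 2 : ℝ) • ∑ j : Fin 3, (z j) • U₁ j z‖ := by gcongr; exact norm_sub_le _ _
      _ ≤ ((‖∑ j : Fin 3, U₂ j z‖ + ‖∑ j : Fin 3, (U z) j • U₁ j z‖) + ‖(1 / 2 : ℝ) • U z‖)
          + ‖(1 / 2 : ℝ) • ∑ j : Fin 3, (z j) • U₁ j z‖ := by gcongr; exact norm_sub_le _ _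
      _ ≤ _ := by linarith
  · -- real-slice agreement with `ssResidual 1 W`
    intro y hy
    have hy' : y ∈ ball (0 : EuclideanSpace ℝ (Fin 3)) (A + 1 - s) := ball_subset_ball (by rw [hs_def]; linarith) hy
    have hy'' : y ∈ ball (0 : EuclideanSpace ℝ (Fin 3)) (A + 1) := ball_subset_ball (by linarith) hy'
    -- `W` is `C²` near `y`
    have hDW : DifferentiableAt ℝ (fderiv ℝ W) y := by
      have h := (hW.fderiv_of_isOpen isOpen_ball (m := 2) (by norm_num)).differentiableOn (by norm_num)
      exact h.differentiableAt (isOpen_ball.mem_nhds hy'')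
    have hcoordW : ∀ j, fderiv ℝ (fun y' => fderiv ℝ W y' (e j)) y (e j) = W₂ j y := fun j => rfl
    rw [ssResidual_one_eq_coord hDW]
    have a0 : U (complexify y) = complexify (W y) := hUW y hy''
    have a1 : ∀ j, U₁ j (complexify y) = complexify (W₁ j y) := fun j => (R1 j).2.2 y hy''
    have a2 : ∀ j, U₂ j (complexify y) = complexify (W₂ j y) := fun j => (R2 j).2.2 y hy'
    simp only [hG_def, a0, a1, a2, complexify_apply, Complex.coe_smul, map_sub, map_sum, LinearIsometry.map_smul]
    rfl

end Summit.NavierStokesRegularity.NavierStokesRegularity.Theorems.ScalingDefectPeepholeDoor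

end
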